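import Literature.AlgebraicGeometry.Motives.AbelianVarietyGaloisCharpolyIsogenyRelations
import Literature.AlgebraicGeometry.Motives.AbelianVarietyInvariantHomCount
import HarnessLib

/-!
# The `ℓ`-adic trace computes dimensions of images of (quasi-)idempotents:
# `Tr(u | T_ℓ X) = a · 2 dim(Im u)` for `u² = a u`, `2|H| · dim B_H = Σ_{h ∈ H} Tr(ρ(h) | T_ℓ X)`, and the lattice
# additive functor lemma `rk_{ℤ_ℓ} (T_ℓ X)^H = rk_{ℤ_ℓ} T_ℓ(B_H) = 2 dim B_H`

For an abelian variety `X` over a field `K`, a prime `ℓ` invertible in `K`, and an endomorphism `u` with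
`u ≫ u = a • u` (`a ∈ ℕ`; `u = a ε` for the idempotent `ε = u/a ∈ End⁰ X` when `a ≠ 0`), the `ℤ_ℓ`-linear map
`T_ℓ u` of the Tate module `T_ℓ X ≅ ℤ_ℓ^{2 dim X}` has trace

  `Tr(T_ℓ u | T_ℓ X) = a · rk_{ℤ_ℓ} T_ℓ(Im u) = a · 2 dim(Im u)`                      (`trace_tateModuleMap_eq_mul_two_mul_dim`).

Mechanism (as for the tree's `ℚ`-character `χ_B`, `Motives/AbelianVarietyIdempotentRelations` §1, now with the additive
functor `T_ℓ` of Dokchitser–Green–Konstantinou–Morgan's "additive functor lemma"): with `ι : Im u ↪ X` and the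
corestriction `ū : X ↠ Im u` one has `ū ≫ ι = u` and `ι ≫ ū = a • 𝟙` (`imageι_comp_toImage_eq_nsmul`), so
`T_ℓ u = T_ℓ ι ∘ T_ℓ ū`, `T_ℓ ū ∘ T_ℓ ι = a`, and `Tr(T_ℓ ι ∘ T_ℓ ū) = Tr(T_ℓ ū ∘ T_ℓ ι) = a · rk T_ℓ(Im u)`; finally
`rk_{ℤ_ℓ} T_ℓ B = 2 dim B` (`finrank_tateModule_eq_two_mul_dim`, Serre–Tate §1 / Mumford §19).  By Milne's Prop. 12.9
("the trace and degree of `α` are the trace and determinant of `α` acting on `T_l A ⊗ ℚ_l`") the left side is the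
trace `Tr(u)` of `u ∈ End X` in the sense of the characteristic polynomial `P_u`; the right side is the value
`χ_ℓ(u) = a · 2 dim ε(X)` of the `ℓ`-adic `ℚ`-character on the quasi-idempotent — the `ℓ`-adic counterpart of the
rational-representation count "`ρ_r` acts on `B_i^{n_i}` by `h_i W_i`; comparing dimensions `2 n_i dim B_i = h_i rk W_i`"
of Lange–Rodríguez (Prop. 2.9.3 and its proof).

For a finite group acting by `ρ : G → End X` and a finite subgroup `H` with norm element `N_H = Σ_{h ∈ H} ρ(h)`
(`N_H ≫ N_H = |H| • N_H`, `norm_comp_norm_eq_card_nsmul`; `B_H := Im N_H = ε_H(X)`), additivity of `T_ℓ` turns this into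
the **`ℓ`-adic dimension formula**

  `2 |H| · dim B_H = Σ_{h ∈ H} Tr(ρ(h) | T_ℓ X)`                (`card_mul_two_mul_dim_image_norm_eq_sum_trace_tateModuleMap`),

i.e. `dim B_H = ½ dim_{ℚ_ℓ} V_ℓ(X)^H` written through `dim V^H = |H|⁻¹ Σ_{h ∈ H} Tr(h | V)` (`V_ℓ(B_H) ≅ V_ℓ(X)^H` is the
additive functor lemma with `F = V_ℓ`; for a curve with `G ≤ Aut` and `X = J`, `B_H ∼ J_{X/H}` and the formula is the
`ℓ`-adic Chevalley–Weil count of `2 g(X/H)` — the quotient-curve reading is not asserted here).  Consequences recorded: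
`B_H = 0 ⟺ Σ_{h ∈ H} Tr(ρ(h) | T_ℓ X) = 0`; the trace of the complementary quasi-idempotent `a − u` (the "Prym part"
`Im(a − u)`, `dim Im u + dim Im(a − u) = dim X`); equality of dimensions of two images as an identity of traces.

§4 proves the additive functor lemma itself for the lattice functor `F = T_ℓ` (no `⊗ ℚ_ℓ` in the tree is needed):
`H` fixes `B_H` pointwise (`ι_H ≫ ρ(h) = ι_H`, "the image of `(π_H)^*` is contained in `(J_X^H)^0`"), so `T_ℓ ι_H` embeds
`T_ℓ B_H` into the invariants `(T_ℓ X)^H = ⋂_{h ∈ H} {x | T_ℓ ρ(h) x = x}`, and `T_ℓ N_H = |H|` on `(T_ℓ X)^H` puts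
`|H| · (T_ℓ X)^H` inside the image ("composition in each direction is multiplication by `|H|`"); as `ℤ_ℓ` is a domain of
characteristic `0`, **`rk_{ℤ_ℓ} (T_ℓ X)^H = rk_{ℤ_ℓ} T_ℓ B_H = 2 dim B_H`** for EVERY `ℓ ≠ char K` (also `ℓ ∣ |H|`), and
with §3 the character formula `|H| · rk (T_ℓ X)^H = Σ_{h ∈ H} Tr(ρ(h) | T_ℓ X)` is recovered geometrically.

§5 (v2) evaluates the `ℓ`-adic character on LITERAL relations `Σ_i c_i u_i = Σ_j d_j v_j` of quasi-idempotents in `End X`: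
the dimension identity of Kani–Rosen's Theorem A with INTEGER coefficients (`Σ_i c_i a_i dim Im u_i = Σ_j d_j b_j dim Im v_j`),
which the tree had for `ℕ`-coefficients over a perfect field as a corollary of the isogeny
(`Motives/AbelianVarietyIdempotentRelations` §7, `sum_mul_dim_image_eq_of_sum_nsmul_eq`), holds over ANY field — the trace
does not need Poincaré reducibility (a prime `ℓ ∈ {2, 3}` invertible in `K` exists, `exists_prime_natCast_ne_zero`).

## Main statements (sorry-free; theorems only, no new definitions)

* §1 functoriality complements of `T_ℓ : Hom(A, B) → Hom_{ℤ_ℓ}(T_ℓ A, T_ℓ B)` (a homomorphism of groups, Mumford §19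
  Thm. 3): `tateModuleMap_neg`, `tateModuleMap_sub`, `tateModuleMap_zsmul`, `tateModuleMap_sum`,
  `trace_tateModuleMap_sum`, `trace_tateModuleMap_sum_zsmul`.
* §2 quasi-idempotents: `tateModuleMap_imageι_comp_tateModuleMap_toImage` (`T_ℓ ι ∘ T_ℓ ū = T_ℓ u`),
  `tateModuleMap_toImage_comp_tateModuleMap_imageι` (`T_ℓ ū ∘ T_ℓ ι = a`), **`trace_tateModuleMap_eq_mul_finrank`**,
  **`trace_tateModuleMap_eq_mul_two_mul_dim`** (`Tr(T_ℓ u) = a · 2 dim Im u`), `trace_tateModuleMap_id_eq_two_mul_dim`,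
  `trace_tateModuleMap_nsmul_id_sub` (complement), `dim_image_eq_zero_iff_trace_tateModuleMap_eq_zero`,
  `dim_image_eq_dim_image_iff_trace_tateModuleMap_eq`.
* §3 finite group actions: `tateModuleMap_norm_eq_sum` (`T_ℓ N_H = Σ_h T_ℓ ρ(h)`),
  **`card_mul_two_mul_dim_image_norm_eq_sum_trace_tateModuleMap`** (`2|H| dim B_H = Σ_{h∈H} Tr(ρ(h) | T_ℓ X)`), the
  whole-group form `card_mul_two_mul_dim_image_normG_eq_sum_trace_tateModuleMap`, and
  `dim_image_norm_eq_zero_iff_sum_trace_tateModuleMap_eq_zero` (`B_H = 0 ⟺ Σ_h Tr = 0`).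
* §4 invariants: `tateModuleMap_imageι_injective` (`T_ℓ ι` injective for `u² = a u`, `a ≠ 0`), `imageι_norm_comp_asHom`
  (`ι_H ≫ ρ(h) = ι_H`), `range_tateModuleMap_imageι_norm_le` (`T_ℓ ι_H(T_ℓ B_H) ⊆ (T_ℓ X)^H`),
  `tateModuleMap_norm_apply_of_mem_iInf_eqLocus` (`T_ℓ N_H = |H|` on invariants),
  `card_smul_mem_range_tateModuleMap_imageι_norm` (`|H| (T_ℓ X)^H ⊆ T_ℓ ι_H(T_ℓ B_H)`),
  **`finrank_iInf_eqLocus_tateModuleMap_eq_finrank`** (`rk (T_ℓ X)^H = rk T_ℓ B_H`, instance form),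
  **`finrank_iInf_eqLocus_tateModuleMap_eq_two_mul_dim`** (`= 2 dim B_H`),
  `card_mul_finrank_iInf_eqLocus_eq_sum_trace_tateModuleMap` (`|H| rk (T_ℓ X)^H = Σ_h Tr(ρ(h) | T_ℓ X)`).
* §5 (v2, same seat, ADD-ONLY) the dimension character over ANY field (a prime `ℓ ∈ {2, 3}` invertible in `K` chosen inside
  the proofs): `mul_two_mul_dim_image_eq_sum_mul_trace_tateModuleMap` (`a · 2 dim Im u = Σ_i c_i Tr(T_ℓ w_i)` for
  `u = Σ_i c_i w_i`), **`sum_mul_dim_image_eq_of_sum_zsmul_eq`** (`Σ_i c_i u_i = Σ_j d_j v_j ⟹ Σ_i c_i a_i dim Im u_i =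
  Σ_j d_j b_j dim Im v_j`, `c, d ∈ ℤ` — the tree's perfect-field `sum_mul_dim_image_eq_of_sum_nsmul_eq` without perfectness
  or signs), `mul_dim_image_eq_sum_of_eq_sum_zsmul`, `mul_dim_eq_sum_of_nsmul_id_eq_sum_zsmul` (`a dim X = Σ_j d_j b_j dim Im v_j`
  for `a·1 = Σ_j d_j v_j`); Theorem B's dimension count itself is the tree's `dim_kaniRosenB`.

Scope (stated, not hidden).  `ℓ` must be invertible in `K` for the dimension forms (the instance forms
`trace_tateModuleMap_eq_mul_finrank`, `finrank_iInf_eqLocus_tateModuleMap_eq_finrank` hold for every prime under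
explicit freeness / finiteness / torsion-freeness instances); traces live in `ℤ_ℓ` (no claim of `ℓ`-independence beyond
the displayed natural-number value); the invariants are the def-free submodule `⨅_{h} eqLocus(T_ℓ ρ(h), id)` (no
`Representation` structure is introduced); `B_H = Im N_H`, no quotient curves.

## References

* [DokchitserEtAl2022] V. Dokchitser, H. Green, A. Konstantinou, A. Morgan, *Parity of ranks of Jacobians of curves*
  (2022), §3, additive functor lemma (`F(Jac_{X/H}) ≅ F(J_X)^H`, composites `= |H|`; `F = V_ℓ`).
* [Milne1986AbelianVarieties] J. S. Milne, *Abelian varieties*, in Cornell–Silverman (1986), §12 Prop. 12.9 (PDF p. 192).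
* [MumfordAV1970] D. Mumford, *Abelian Varieties* (1970), §19 Thm. 3 (p. 176) and Thm. 4 (p. 180).
* [SerreTate1968] J.-P. Serre, J. Tate, *Good reduction of abelian varieties*, Ann. Math. 88 (1968), §1 (p. 493).
* [LangeRodriguez2022] H. Lange, R. E. Rodríguez, *Decomposition of Jacobians by Prym Varieties*, LNM 2310 (2022),
  §2.3 (rational trace, PDF p. 29) and Prop. 2.9.3 with proof (PDF p. 46).
* [KaniRosen1989] E. Kani, M. Rosen, *Idempotent relations and factors of Jacobians*, Math. Ann. 284 (1989), Thm. B.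
* [Paulhus2008] J. Paulhus, *Decomposing Jacobians of curves with extra automorphisms*, Acta Arith. 132 (2008), §2 (p. 232).
-/

noncomputable section

open CategoryTheory CategoryTheory.Limits
open Literature.NumberTheory.DiophantineGeometry

universe u

namespace Literature.AlgebraicGeometry.Motives

namespace AbelianVariety

variable {K : Type u} [Field K]

/-! ## §1 Functoriality complements: `T_ℓ` is a homomorphism `Hom(A, B) → Hom_{ℤ_ℓ}(T_ℓ A, T_ℓ B)` -/

section Functoriality

variable (ℓ : ℕ) [Fact ℓ.Prime] {A B : AbelianVariety K}

/-- `T_ℓ(−f) = −T_ℓ f` (`T_ℓ : Hom(A, B) → Hom(T_ℓ A, T_ℓ B)` is a homomorphism). [cite: MumfordAV1970, §19 Thm. 3 (p. 176)] -/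
theorem tateModuleMap_neg (f : A ⟶ B) : tateModuleMap ℓ (-f) = -tateModuleMap ℓ f :=
  eq_neg_of_add_eq_zero_left (by rw [← tateModuleMap_add, neg_add_cancel, tateModuleMap_zero])

/-- `T_ℓ(f − g) = T_ℓ f − T_ℓ g`. [cite: MumfordAV1970, §19 Thm. 3 (p. 176)] -/
theorem tateModuleMap_sub (f g : A ⟶ B) : tateModuleMap ℓ (f - g) = tateModuleMap ℓ f - tateModuleMap ℓ g := by
  rw [sub_eq_add_neg, tateModuleMap_add, tateModuleMap_neg, ← sub_eq_add_neg]

/-- `T_ℓ(n • f) = n • T_ℓ f` for `n ∈ ℤ`. [cite: MumfordAV1970, §19 Thm. 3 (p. 176)] -/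
theorem tateModuleMap_zsmul (n : ℤ) (f : A ⟶ B) : tateModuleMap ℓ (n • f) = n • tateModuleMap ℓ f := by
  induction n using Int.induction_on with
  | zero => rw [zero_smul, zero_smul, tateModuleMap_zero]
  | succ n ih => rw [add_smul, one_smul, tateModuleMap_add, ih, add_smul, one_smul]
  | pred n ih => rw [sub_smul, one_smul, tateModuleMap_sub, ih, sub_smul, one_smul]

/-- `T_ℓ(Σ_{i ∈ s} f_i) = Σ_{i ∈ s} T_ℓ f_i`. [cite: MumfordAV1970, §19 Thm. 3 (p. 176)] -/
theorem tateModuleMap_sum {I : Type*} (s : Finset I) (f : I → (A ⟶ B)) :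
    tateModuleMap ℓ (∑ i ∈ s, f i) = ∑ i ∈ s, tateModuleMap ℓ (f i) :=
  map_sum (AddMonoidHom.mk' (fun g : A ⟶ B ↦ tateModuleMap ℓ g) (tateModuleMap_add ℓ)) f s

/-- `T_ℓ(Σ_i c_i • w_i) = Σ_i c_i • T_ℓ w_i` (`c_i ∈ ℤ`). [cite: MumfordAV1970, §19 Thm. 3 (p. 176)] -/
theorem tateModuleMap_sum_zsmul {I : Type*} (s : Finset I) (c : I → ℤ) (w : I → (A ⟶ B)) :
    tateModuleMap ℓ (∑ i ∈ s, c i • w i) = ∑ i ∈ s, c i • tateModuleMap ℓ (w i) := by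
  rw [tateModuleMap_sum]
  exact Finset.sum_congr rfl fun i _ ↦ tateModuleMap_zsmul ℓ (c i) (w i)

variable {X : AbelianVariety K}

/-- **The `ℓ`-adic trace is additive on `End X`**: `Tr(T_ℓ(Σ_{i ∈ s} w_i)) = Σ_{i ∈ s} Tr(T_ℓ w_i)`.
[cite: MumfordAV1970, §19 Thm. 3 (p. 176) and Thm. 4 (p. 180)] -/
theorem trace_tateModuleMap_sum {I : Type*} (s : Finset I) (w : I → (X ⟶ X)) :
    LinearMap.trace ℤ_[ℓ] (X.tateModule ℓ) (tateModuleMap ℓ (∑ i ∈ s, w i)) =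
      ∑ i ∈ s, LinearMap.trace ℤ_[ℓ] (X.tateModule ℓ) (tateModuleMap ℓ (w i)) := by
  rw [tateModuleMap_sum, map_sum]

/-- **The `ℓ`-adic trace is `ℤ`-linear on `End X`**: `Tr(T_ℓ(Σ_i c_i w_i)) = Σ_i c_i Tr(T_ℓ w_i)` — the `ℓ`-adic
`ℚ`-character `χ_ℓ = Tr ∘ T_ℓ` evaluated on an integral linear combination. [cite: MumfordAV1970, §19 Thm. 4 (p. 180)]
[cite: Milne1986AbelianVarieties, §12 Prop. 12.9 (PDF p. 192)] -/
theorem trace_tateModuleMap_sum_zsmul {I : Type*} (s : Finset I) (c : I → ℤ) (w : I → (X ⟶ X)) :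
    LinearMap.trace ℤ_[ℓ] (X.tateModule ℓ) (tateModuleMap ℓ (∑ i ∈ s, c i • w i)) =
      ∑ i ∈ s, (c i : ℤ_[ℓ]) * LinearMap.trace ℤ_[ℓ] (X.tateModule ℓ) (tateModuleMap ℓ (w i)) := by
  rw [tateModuleMap_sum_zsmul, map_sum]
  exact Finset.sum_congr rfl fun i _ ↦ by rw [map_zsmul, zsmul_eq_mul]

end Functoriality

/-! ## §2 Quasi-idempotents: `Tr(T_ℓ u) = a · rk T_ℓ(Im u) = a · 2 dim(Im u)` -/

section QuasiIdempotent

variable (ℓ : ℕ) [Fact ℓ.Prime] {X : AbelianVariety K} {u : X ⟶ X} {a : ℕ}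

/-- `T_ℓ ι ∘ T_ℓ ū = T_ℓ u` for the factorisation `u = (X ↠ Im u ↪ X)` (`ū ≫ ι = u`, functoriality of `T_ℓ`).
[cite: DokchitserEtAl2022, §3 (additive functor lemma)] [cite: MumfordAV1970, §19 Thm. 3 (p. 176)] -/
theorem tateModuleMap_imageι_comp_tateModuleMap_toImage (u : X ⟶ X) :
    tateModuleMap ℓ (imageι u) ∘ₗ tateModuleMap ℓ (toImage u) = tateModuleMap ℓ u := by
  rw [← tateModuleMap_comp, toImage_imageι]

/-- `T_ℓ ū ∘ T_ℓ ι = a` on `T_ℓ(Im u)` for a quasi-idempotent `u ≫ u = a • u` (`ι ≫ ū = a • 𝟙_{Im u}`: "the maps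
`F(π_H^*)` and `F((π_H)_*)` … whose composition in each direction is multiplication by `|H|`").
[cite: DokchitserEtAl2022, §3 (additive functor lemma)] [cite: MumfordAV1970, §19 Thm. 3 (p. 176)] -/
theorem tateModuleMap_toImage_comp_tateModuleMap_imageι (hu : u ≫ u = a • u) :
    tateModuleMap ℓ (toImage u) ∘ₗ tateModuleMap ℓ (imageι u) = (a : ℤ_[ℓ]) • LinearMap.id := by
  rw [← tateModuleMap_comp, imageι_comp_toImage_eq_nsmul hu, ← natCast_zsmul, tateModuleMap_zsmul, tateModuleMap_id,
    ← Int.cast_smul_eq_zsmul ℤ_[ℓ], Int.cast_natCast]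

/-- **`Tr(T_ℓ u | T_ℓ X) = a · rk_{ℤ_ℓ} T_ℓ(Im u)` for `u ≫ u = a • u`** (instance form, any prime `ℓ`): `T_ℓ u = T_ℓ ι ∘ T_ℓ ū`,
`Tr(T_ℓ ι ∘ T_ℓ ū) = Tr(T_ℓ ū ∘ T_ℓ ι) = Tr(a · id) = a · rk T_ℓ(Im u)` — the `ℓ`-adic twin of the tree's
`trace_leftComp_eq_mul_finrank` (`χ_B(u) = a · rk Hom(Im u, B)`). [cite: DokchitserEtAl2022, §3 (additive functor lemma, `F = V_ℓ`)]
[cite: Milne1986AbelianVarieties, §12 Prop. 12.9 (PDF p. 192)] [cite: MumfordAV1970, §19 Thm. 4 (p. 180)] -/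
theorem trace_tateModuleMap_eq_mul_finrank (hu : u ≫ u = a • u)
    [Module.Free ℤ_[ℓ] (X.tateModule ℓ)] [Module.Finite ℤ_[ℓ] (X.tateModule ℓ)]
    [Module.Free ℤ_[ℓ] ((image u).tateModule ℓ)] [Module.Finite ℤ_[ℓ] ((image u).tateModule ℓ)] :
    LinearMap.trace ℤ_[ℓ] (X.tateModule ℓ) (tateModuleMap ℓ u) =
      a * Module.finrank ℤ_[ℓ] ((image u).tateModule ℓ) := by
  rw [← tateModuleMap_imageι_comp_tateModuleMap_toImage ℓ u, LinearMap.trace_comp_comm',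
    tateModuleMap_toImage_comp_tateModuleMap_imageι ℓ hu, map_smul, LinearMap.trace_id, smul_eq_mul]

/-- **`Tr(T_ℓ u | T_ℓ X) = a · 2 dim(Im u)` for `u ≫ u = a • u` and `ℓ` invertible in `K`** — the `ℓ`-adic `ℚ`-character
on a quasi-idempotent computes the dimension of its image (`χ_ℓ(ε) = 2 dim ε(X)` for the idempotent `ε = u/a`; the
`ℓ`-adic counterpart of "`ρ_r` acts on `B_i^{n_i}` by `h_i W_i`; comparing dimensions `2 n_i dim B_i = h_i rk W_i`").
Unconditional: `rk_{ℤ_ℓ} T_ℓ B = 2 dim B` is `finrank_tateModule_eq_two_mul_dim`. [cite: DokchitserEtAl2022, §3 (additive functor lemma, `F = V_ℓ`)]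
[cite: Milne1986AbelianVarieties, §12 Prop. 12.9 (PDF p. 192)] [cite: LangeRodriguez2022, §2.9.1 Prop. 2.9.3 and proof (PDF p. 46)]
[cite: SerreTate1968, §1 (p. 493)] -/
theorem trace_tateModuleMap_eq_mul_two_mul_dim (hu : u ≫ u = a • u) (hℓ : (ℓ : K) ≠ 0) :
    LinearMap.trace ℤ_[ℓ] (X.tateModule ℓ) (tateModuleMap ℓ u) = (a * (2 * (image u).dim) : ℕ) := by
  haveI := X.module_free_tateModule_holds ℓ hℓ
  haveI := module_finite_tateModule_of_cast_ne_zero X ℓ hℓ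
  haveI := (image u).module_free_tateModule_holds ℓ hℓ
  haveI := module_finite_tateModule_of_cast_ne_zero (image u) ℓ hℓ
  rw [trace_tateModuleMap_eq_mul_finrank ℓ hu, (image u).finrank_tateModule_eq_two_mul_dim ℓ hℓ]
  push_cast
  ring

/-- `Tr(𝟙 | T_ℓ X) = rk_{ℤ_ℓ} T_ℓ X = 2 dim X` (`ℓ` invertible in `K`). [cite: SerreTate1968, §1 (p. 493)]
[cite: MumfordAV1970, §19 Thm. 4 (p. 180)] -/
theorem trace_tateModuleMap_id_eq_two_mul_dim (X : AbelianVariety K) (hℓ : (ℓ : K) ≠ 0) :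
    LinearMap.trace ℤ_[ℓ] (X.tateModule ℓ) (tateModuleMap ℓ (𝟙 X)) = (2 * X.dim : ℕ) := by
  haveI := X.module_free_tateModule_holds ℓ hℓ
  haveI := module_finite_tateModule_of_cast_ne_zero X ℓ hℓ
  rw [tateModuleMap_id, LinearMap.trace_id, X.finrank_tateModule_eq_two_mul_dim ℓ hℓ]

/-- **Trace of the complementary quasi-idempotent** `a − u` (`(a − u)² = a (a − u)`, `sub_comp_sub_eq_nsmul`; its image
`Im(a − u)` is the complementary abelian subvariety / "Prym part", `dim Im u + dim Im(a − u) = dim X`):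
`Tr(T_ℓ(a − u)) = a · 2 dim X − Tr(T_ℓ u)`. [cite: MumfordAV1970, §19 Thm. 4 (p. 180)]
[cite: LangeRodriguez2022, §2.9.1 Prop. 2.9.3 and proof (PDF p. 46)] -/
theorem trace_tateModuleMap_nsmul_id_sub (u : X ⟶ X) (a : ℕ) (hℓ : (ℓ : K) ≠ 0) :
    LinearMap.trace ℤ_[ℓ] (X.tateModule ℓ) (tateModuleMap ℓ (a • 𝟙 X - u)) =
      (a * (2 * X.dim) : ℕ) - LinearMap.trace ℤ_[ℓ] (X.tateModule ℓ) (tateModuleMap ℓ u) := by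
  rw [tateModuleMap_sub, map_sub, ← natCast_zsmul, tateModuleMap_zsmul, map_zsmul,
    trace_tateModuleMap_id_eq_two_mul_dim ℓ X hℓ, zsmul_eq_mul, Int.cast_natCast, ← Nat.cast_mul]

/-- **Both traces of a complementary pair add up to `a · 2 dim X`**: `Tr(T_ℓ u) + Tr(T_ℓ(a − u)) = a · 2 dim X`, i.e.
(`a ≠ 0`) `dim Im u + dim Im(a − u) = dim X` read through `T_ℓ`. [cite: LangeRodriguez2022, §2.9.1 Prop. 2.9.3 and proof (PDF p. 46)]
[cite: MumfordAV1970, §19 Thm. 4 (p. 180)] -/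
theorem trace_tateModuleMap_add_trace_tateModuleMap_nsmul_id_sub (u : X ⟶ X) (a : ℕ) (hℓ : (ℓ : K) ≠ 0) :
    LinearMap.trace ℤ_[ℓ] (X.tateModule ℓ) (tateModuleMap ℓ u) +
        LinearMap.trace ℤ_[ℓ] (X.tateModule ℓ) (tateModuleMap ℓ (a • 𝟙 X - u)) = (a * (2 * X.dim) : ℕ) := by
  rw [trace_tateModuleMap_nsmul_id_sub ℓ u a hℓ, add_sub_cancel]

/-- **`Im u = 0 ⟺ Tr(T_ℓ u) = 0`** for a quasi-idempotent `u ≫ u = a • u` with `a ≠ 0` (`ℓ` invertible in `K`):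
`Tr(T_ℓ u) = a · 2 dim Im u` in the characteristic-zero ring `ℤ_ℓ` ("`dim B_l = 0` if and only if
`⟨ρ, W_l⟩ = 0`", `ℓ`-adically). [cite: LangeRodriguez2022, §2.9.1 Prop. 2.9.3 (ii) (PDF p. 46)]
[cite: Milne1986AbelianVarieties, §12 Prop. 12.9 (PDF p. 192)] -/
theorem dim_image_eq_zero_iff_trace_tateModuleMap_eq_zero (hu : u ≫ u = a • u) (ha : a ≠ 0) (hℓ : (ℓ : K) ≠ 0) :
    (image u).dim = 0 ↔ LinearMap.trace ℤ_[ℓ] (X.tateModule ℓ) (tateModuleMap ℓ u) = 0 := by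
  rw [trace_tateModuleMap_eq_mul_two_mul_dim ℓ hu hℓ, Nat.cast_eq_zero, mul_eq_zero, mul_eq_zero]
  omega

/-- **Equality of dimensions of two images as an identity of `ℓ`-adic traces**: for quasi-idempotents `u² = a u`,
`v² = b v` (`a, b ≠ 0`), `dim Im u = dim Im v ⟺ b · Tr(T_ℓ u) = a · Tr(T_ℓ v)`. [cite: Milne1986AbelianVarieties, §12 Prop. 12.9 (PDF p. 192)]
[cite: LangeRodriguez2022, §2.9.1 Prop. 2.9.3 (ii) (PDF p. 46)] -/
theorem dim_image_eq_dim_image_iff_trace_tateModuleMap_eq {v : X ⟶ X} {b : ℕ} (hu : u ≫ u = a • u) (ha : a ≠ 0)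
    (hv : v ≫ v = b • v) (hb : b ≠ 0) (hℓ : (ℓ : K) ≠ 0) :
    (image u).dim = (image v).dim ↔
      (b : ℤ_[ℓ]) * LinearMap.trace ℤ_[ℓ] (X.tateModule ℓ) (tateModuleMap ℓ u) =
        a * LinearMap.trace ℤ_[ℓ] (X.tateModule ℓ) (tateModuleMap ℓ v) := by
  rw [trace_tateModuleMap_eq_mul_two_mul_dim ℓ hu hℓ, trace_tateModuleMap_eq_mul_two_mul_dim ℓ hv hℓ, ← Nat.cast_mul,
    ← Nat.cast_mul, Nat.cast_inj]
  constructor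
  · intro h; rw [h]; ring
  · intro h
    have h' : a * b * (2 * (image u).dim) = a * b * (2 * (image v).dim) := by
      calc a * b * (2 * (image u).dim) = b * (a * (2 * (image u).dim)) := by ring
        _ = a * (b * (2 * (image v).dim)) := h
        _ = a * b * (2 * (image v).dim) := by ring
    have hab : a * b ≠ 0 := mul_ne_zero ha hb
    have := Nat.eq_of_mul_eq_mul_left (Nat.pos_of_ne_zero hab) h'
    omega

end QuasiIdempotent

/-! ## §3 Finite group actions: `2|H| · dim B_H = Σ_{h ∈ H} Tr(ρ(h) | T_ℓ X)` -/

section GroupAction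

variable (ℓ : ℕ) [Fact ℓ.Prime] {X : AbelianVariety K} {G : Type} [Group G] (ρ : G →* End X)

/-- `T_ℓ N_H = Σ_{h ∈ H} T_ℓ ρ(h)` for the norm element `N_H = Σ_{h ∈ H} ρ(h)` of a finite subgroup (additivity of
`T_ℓ`). [cite: MumfordAV1970, §19 Thm. 3 (p. 176)] [cite: DokchitserEtAl2022, §3 (additive functor lemma)] -/
theorem tateModuleMap_norm_eq_sum {H₀ : Subgroup G} [Fintype H₀] {N₀ : X ⟶ X} (hN₀ : End.of N₀ = ∑ h : H₀, ρ h) :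
    tateModuleMap ℓ N₀ = ∑ h : H₀, tateModuleMap ℓ (End.asHom (ρ h)) := by
  have h : N₀ = ∑ h : H₀, End.asHom (ρ h) := hN₀
  rw [h, tateModuleMap_sum]

/-- **The `ℓ`-adic dimension formula for `B_H = Im N_H`**: for a finite subgroup `H` acting through `ρ : G → End X`
and `ℓ` invertible in `K`,
`|H| · 2 dim B_H = Σ_{h ∈ H} Tr(ρ(h) | T_ℓ X)` — i.e. `dim B_H = ½ dim V_ℓ(X)^H` with `dim V^H = |H|⁻¹ Σ_h Tr(h)`
(`V_ℓ(B_H) ≅ V_ℓ(X)^H`, the additive functor lemma with `F = V_ℓ`; here from `N_H ≫ N_H = |H| • N_H`,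
`Tr(T_ℓ N_H) = |H| · 2 dim Im N_H` and additivity). [cite: DokchitserEtAl2022, §3 (additive functor lemma, `F = V_ℓ`)]
[cite: LangeRodriguez2022, §2.9.1 Prop. 2.9.3 and proof (PDF p. 46)] [cite: Milne1986AbelianVarieties, §12 Prop. 12.9 (PDF p. 192)]
[cite: Paulhus2008, §2 ("ε_H = (1/|H|) Σ_{h ∈ H} h", p. 232)] -/
theorem card_mul_two_mul_dim_image_norm_eq_sum_trace_tateModuleMap {H₀ : Subgroup G} [Fintype H₀] {N₀ : X ⟶ X}
    (hN₀ : End.of N₀ = ∑ h : H₀, ρ h) (hℓ : (ℓ : K) ≠ 0) :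
    ((Fintype.card H₀ * (2 * (image N₀).dim) : ℕ) : ℤ_[ℓ]) =
      ∑ h : H₀, LinearMap.trace ℤ_[ℓ] (X.tateModule ℓ) (tateModuleMap ℓ (End.asHom (ρ h))) := by
  rw [← trace_tateModuleMap_eq_mul_two_mul_dim ℓ (norm_comp_norm_eq_card_nsmul ρ hN₀) hℓ,
    tateModuleMap_norm_eq_sum ℓ ρ hN₀, map_sum]

/-- The whole-group form: `|G| · 2 dim B_G = Σ_{g ∈ G} Tr(ρ(g) | T_ℓ X)` for `N_G = Σ_g ρ(g)`, `B_G = Im N_G`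
(`dim B_G = ½ dim V_ℓ(X)^G`). [cite: DokchitserEtAl2022, §3 (additive functor lemma, `F = V_ℓ`)]
[cite: LangeRodriguez2022, §2.9.1 Prop. 2.9.3 and proof (PDF p. 46)] [cite: KaniRosen1989, Thm. B] -/
theorem card_mul_two_mul_dim_image_normG_eq_sum_trace_tateModuleMap [Fintype G] {NG : X ⟶ X}
    (hNG : End.of NG = ∑ g, ρ g) (hℓ : (ℓ : K) ≠ 0) :
    ((Fintype.card G * (2 * (image NG).dim) : ℕ) : ℤ_[ℓ]) =
      ∑ g, LinearMap.trace ℤ_[ℓ] (X.tateModule ℓ) (tateModuleMap ℓ (End.asHom (ρ g))) := by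
  have h : NG = ∑ g, End.asHom (ρ g) := hNG
  rw [← trace_tateModuleMap_eq_mul_two_mul_dim ℓ (normG_comp_normG_eq_card_nsmul ρ hNG) hℓ, h, tateModuleMap_sum,
    map_sum]

/-- **`B_H = 0 ⟺ Σ_{h ∈ H} Tr(ρ(h) | T_ℓ X) = 0`** (`ℓ` invertible in `K`): the `ℓ`-adic vanishing criterion for the
factor `B_H = Im N_H` ("`dim B = 0` if and only if `⟨ρ, W⟩ = 0`"). [cite: LangeRodriguez2022, §2.9.1 Prop. 2.9.3 (ii) (PDF p. 46)]
[cite: DokchitserEtAl2022, §3 (additive functor lemma, `F = V_ℓ`)] -/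
theorem dim_image_norm_eq_zero_iff_sum_trace_tateModuleMap_eq_zero {H₀ : Subgroup G} [Fintype H₀] {N₀ : X ⟶ X}
    (hN₀ : End.of N₀ = ∑ h : H₀, ρ h) (hℓ : (ℓ : K) ≠ 0) :
    (image N₀).dim = 0 ↔ ∑ h : H₀, LinearMap.trace ℤ_[ℓ] (X.tateModule ℓ) (tateModuleMap ℓ (End.asHom (ρ h))) = 0 := by
  rw [← card_mul_two_mul_dim_image_norm_eq_sum_trace_tateModuleMap ℓ ρ hN₀ hℓ, Nat.cast_eq_zero, mul_eq_zero,
    mul_eq_zero]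
  have : Fintype.card H₀ ≠ 0 := Fintype.card_ne_zero
  omega

end GroupAction

/-! ## §4 The lattice form of the additive functor lemma: `rk_{ℤ_ℓ} (T_ℓ X)^H = rk_{ℤ_ℓ} T_ℓ(B_H) = 2 dim B_H` -/

section Invariants

variable (ℓ : ℕ) [Fact ℓ.Prime] {X : AbelianVariety K}

/-- **`T_ℓ ι` is injective** for the inclusion `ι : Im u ↪ X` of the image of a quasi-idempotent `u ≫ u = a • u` with
`a ≠ 0`, as soon as `T_ℓ(Im u)` is `ℤ_ℓ`-torsion-free (e.g. free): `T_ℓ ū ∘ T_ℓ ι = a`. [cite: DokchitserEtAl2022, §3 (additive functor lemma)]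
[cite: MumfordAV1970, §19 Thm. 3 (p. 176)] -/
theorem tateModuleMap_imageι_injective {u : X ⟶ X} {a : ℕ} (hu : u ≫ u = a • u) (ha : a ≠ 0)
    [Module.IsTorsionFree ℤ_[ℓ] ((image u).tateModule ℓ)] :
    Function.Injective (tateModuleMap ℓ (imageι u)) := by
  intro y y' h
  have key := congrArg (tateModuleMap ℓ (toImage u)) h
  rw [← LinearMap.comp_apply, ← LinearMap.comp_apply, tateModuleMap_toImage_comp_tateModuleMap_imageι ℓ hu,
    LinearMap.smul_apply, LinearMap.smul_apply, LinearMap.id_apply, LinearMap.id_apply] at key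
  exact smul_right_injective _ (Nat.cast_ne_zero.2 ha) key

variable {G : Type} [Group G] (ρ : G →* End X) {H₀ : Subgroup G} [Fintype H₀] {N₀ : X ⟶ X}

/-- **`H` fixes `B_H = Im N_H` pointwise**: `ι_H ≫ ρ(h) = ι_H` for `h ∈ H` (`N_H ≫ ρ(h) = N_H` and `X ↠ Im N_H` is an
epimorphism) — "the image of `(π_H)^*` is contained in `(J_X^H)^0`". [cite: DokchitserEtAl2022, §3 (Lemma: `Im (π_H)^* ⊆ (J_X^H)^0`)]
[cite: LangeRodriguez2022, §3.5.2 proof of Prop. 3.5.7 ("`Im(p_H)` is the connected component containing 0 of `J̃^H`", PDF p. 69)] -/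
theorem imageι_norm_comp_asHom (hN₀ : End.of N₀ = ∑ h : H₀, ρ h) (h : H₀) :
    imageι N₀ ≫ End.asHom (ρ h) = imageι N₀ := by
  haveI := epi_of_surjective_toSchemeHom (toImage N₀)
  rw [← cancel_epi (toImage N₀), ← Category.assoc, toImage_imageι, norm_comp_map_eq ρ hN₀ h]

/-- `T_ℓ ρ(h) ∘ T_ℓ ι_H = T_ℓ ι_H` for `h ∈ H`. [cite: DokchitserEtAl2022, §3 (additive functor lemma)]
[cite: MumfordAV1970, §19 Thm. 3 (p. 176)] -/
theorem tateModuleMap_asHom_comp_tateModuleMap_imageι_norm (hN₀ : End.of N₀ = ∑ h : H₀, ρ h) (h : H₀) :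
    tateModuleMap ℓ (End.asHom (ρ h)) ∘ₗ tateModuleMap ℓ (imageι N₀) = tateModuleMap ℓ (imageι N₀) := by
  rw [← tateModuleMap_comp, imageι_norm_comp_asHom ρ hN₀ h]

/-- **`T_ℓ ι_H (T_ℓ B_H) ⊆ (T_ℓ X)^H`**, the `H`-invariants being written as the submodule
`⋂_{h ∈ H} {x | T_ℓ ρ(h) x = x}`. [cite: DokchitserEtAl2022, §3 (additive functor lemma: `F(π_H^*)` lands in `F(J_X)^H`)] -/
theorem range_tateModuleMap_imageι_norm_le (hN₀ : End.of N₀ = ∑ h : H₀, ρ h) :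
    LinearMap.range (tateModuleMap ℓ (imageι N₀)) ≤
      ⨅ h : H₀, LinearMap.eqLocus (tateModuleMap ℓ (End.asHom (ρ h))) LinearMap.id := by
  rintro _ ⟨y, rfl⟩
  refine (Submodule.mem_iInf _).2 fun h ↦ LinearMap.mem_eqLocus.2 ?_
  rw [LinearMap.id_apply, ← LinearMap.comp_apply, tateModuleMap_asHom_comp_tateModuleMap_imageι_norm ℓ ρ hN₀ h]

/-- **`T_ℓ N_H = |H|` on the `H`-invariants of `T_ℓ X`** (`T_ℓ N_H = Σ_{h ∈ H} T_ℓ ρ(h)`).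
[cite: DokchitserEtAl2022, §3 (additive functor lemma: "`N_H` acts as multiplication by `|H|` on `J_X^H`")] -/
theorem tateModuleMap_norm_apply_of_mem_iInf_eqLocus (hN₀ : End.of N₀ = ∑ h : H₀, ρ h) {x : X.tateModule ℓ}
    (hx : x ∈ ⨅ h : H₀, LinearMap.eqLocus (tateModuleMap ℓ (End.asHom (ρ h))) LinearMap.id) :
    tateModuleMap ℓ N₀ x = (Fintype.card H₀ : ℤ_[ℓ]) • x := by
  have hx' : ∀ h : H₀, tateModuleMap ℓ (End.asHom (ρ h)) x = x := fun h ↦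
    LinearMap.mem_eqLocus.1 ((Submodule.mem_iInf _).1 hx h)
  rw [tateModuleMap_norm_eq_sum ℓ ρ hN₀, LinearMap.sum_apply, Finset.sum_congr rfl fun h _ ↦ hx' h, Finset.sum_const,
    Finset.card_univ, Nat.cast_smul_eq_nsmul]

/-- **`|H| · (T_ℓ X)^H ⊆ T_ℓ ι_H (T_ℓ B_H)`**: for an `H`-invariant `x`, `|H| x = T_ℓ N_H x = T_ℓ ι_H (T_ℓ N̄_H x)` — with
`range_tateModuleMap_imageι_norm_le`, "the composition in each direction is multiplication by `|H|`".
[cite: DokchitserEtAl2022, §3 (additive functor lemma)] -/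
theorem card_smul_mem_range_tateModuleMap_imageι_norm (hN₀ : End.of N₀ = ∑ h : H₀, ρ h) {x : X.tateModule ℓ}
    (hx : x ∈ ⨅ h : H₀, LinearMap.eqLocus (tateModuleMap ℓ (End.asHom (ρ h))) LinearMap.id) :
    (Fintype.card H₀ : ℤ_[ℓ]) • x ∈ LinearMap.range (tateModuleMap ℓ (imageι N₀)) :=
  ⟨tateModuleMap ℓ (toImage N₀) x, by
    rw [← LinearMap.comp_apply, tateModuleMap_imageι_comp_tateModuleMap_toImage,
      tateModuleMap_norm_apply_of_mem_iInf_eqLocus ℓ ρ hN₀ hx]⟩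

/-- **The additive functor lemma for `F = T_ℓ`, lattice form: `rk_{ℤ_ℓ} (T_ℓ X)^H = rk_{ℤ_ℓ} T_ℓ(B_H)`** (instance
form, any prime `ℓ` with `T_ℓ X` finitely generated and `T_ℓ X`, `T_ℓ B_H` torsion-free): `T_ℓ ι_H` embeds `T_ℓ B_H`
into `(T_ℓ X)^H` with `|H| · (T_ℓ X)^H` inside the image, and multiplication by `|H| ≠ 0` is injective on the
torsion-free `ℤ_ℓ`-module `(T_ℓ X)^H` ("each map is an isomorphism" after `⊗ ℚ_ℓ`: `V_ℓ(B_H) ≅ V_ℓ(X)^H`).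
[cite: DokchitserEtAl2022, §3 (additive functor lemma, `F = V_ℓ`)] -/
theorem finrank_iInf_eqLocus_tateModuleMap_eq_finrank (hN₀ : End.of N₀ = ∑ h : H₀, ρ h)
    [Module.Finite ℤ_[ℓ] (X.tateModule ℓ)] [Module.IsTorsionFree ℤ_[ℓ] (X.tateModule ℓ)]
    [Module.IsTorsionFree ℤ_[ℓ] ((image N₀).tateModule ℓ)] :
    Module.finrank ℤ_[ℓ] ↥(⨅ h : H₀, LinearMap.eqLocus (tateModuleMap ℓ (End.asHom (ρ h))) LinearMap.id) =
      Module.finrank ℤ_[ℓ] ((image N₀).tateModule ℓ) := by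
  set V := ⨅ h : H₀, LinearMap.eqLocus (tateModuleMap ℓ (End.asHom (ρ h))) LinearMap.id with hV
  have hc : (Fintype.card H₀ : ℤ_[ℓ]) ≠ 0 := Nat.cast_ne_zero.2 Fintype.card_ne_zero
  have hinj := tateModuleMap_imageι_injective ℓ (norm_comp_norm_eq_card_nsmul ρ hN₀) Fintype.card_ne_zero
  refine le_antisymm ?_ ?_
  · let φ : V →ₗ[ℤ_[ℓ]] LinearMap.range (tateModuleMap ℓ (imageι N₀)) :=
      LinearMap.codRestrict _ ((Fintype.card H₀ : ℤ_[ℓ]) • V.subtype) fun x ↦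
        card_smul_mem_range_tateModuleMap_imageι_norm ℓ ρ hN₀ x.2
    have hφ : Function.Injective φ := fun x y hxy ↦
      Subtype.ext (smul_right_injective (X.tateModule ℓ) hc (congrArg Subtype.val hxy))
    exact (LinearMap.finrank_le_finrank_of_injective hφ).trans_eq (LinearMap.finrank_range_of_inj hinj)
  · rw [← LinearMap.finrank_range_of_inj hinj]
    exact Submodule.finrank_mono (range_tateModuleMap_imageι_norm_le ℓ ρ hN₀)

/-- **`rk_{ℤ_ℓ} (T_ℓ X)^H = 2 dim B_H`** for `ℓ` invertible in `K` (`dim B_H = ½ dim V_ℓ(X)^H`; for `X = J_X` and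
`G ≤ Aut X` this is `dim V_ℓ(J_X)^H = 2 g(X/H)`, not asserted here). [cite: DokchitserEtAl2022, §3 (additive functor lemma, `F = V_ℓ`)]
[cite: SerreTate1968, §1 (p. 493)] -/
theorem finrank_iInf_eqLocus_tateModuleMap_eq_two_mul_dim (hN₀ : End.of N₀ = ∑ h : H₀, ρ h) (hℓ : (ℓ : K) ≠ 0) :
    Module.finrank ℤ_[ℓ] ↥(⨅ h : H₀, LinearMap.eqLocus (tateModuleMap ℓ (End.asHom (ρ h))) LinearMap.id) =
      2 * (image N₀).dim := by
  haveI := X.module_free_tateModule_holds ℓ hℓ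
  haveI := module_finite_tateModule_of_cast_ne_zero X ℓ hℓ
  haveI := (image N₀).module_free_tateModule_holds ℓ hℓ
  rw [finrank_iInf_eqLocus_tateModuleMap_eq_finrank ℓ ρ hN₀, (image N₀).finrank_tateModule_eq_two_mul_dim ℓ hℓ]

/-- **The character formula, recovered geometrically: `|H| · rk (T_ℓ X)^H = Σ_{h ∈ H} Tr(ρ(h) | T_ℓ X)`** — both sides
equal `|H| · 2 dim B_H` (§3 and the lattice additive functor lemma). [cite: DokchitserEtAl2022, §3 (additive functor lemma, `F = V_ℓ`)]
[cite: LangeRodriguez2022, §2.9.1 Prop. 2.9.3 and proof (PDF p. 46)] -/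
theorem card_mul_finrank_iInf_eqLocus_eq_sum_trace_tateModuleMap (hN₀ : End.of N₀ = ∑ h : H₀, ρ h)
    (hℓ : (ℓ : K) ≠ 0) :
    ((Fintype.card H₀ *
        Module.finrank ℤ_[ℓ] ↥(⨅ h : H₀, LinearMap.eqLocus (tateModuleMap ℓ (End.asHom (ρ h))) LinearMap.id) : ℕ) :
        ℤ_[ℓ]) =
      ∑ h : H₀, LinearMap.trace ℤ_[ℓ] (X.tateModule ℓ) (tateModuleMap ℓ (End.asHom (ρ h))) := by
  rw [finrank_iInf_eqLocus_tateModuleMap_eq_two_mul_dim ℓ ρ hN₀ hℓ]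
  exact card_mul_two_mul_dim_image_norm_eq_sum_trace_tateModuleMap ℓ ρ hN₀ hℓ

end Invariants

/-! ## §5 (v2) The dimension character is `ℤ`-linear over ANY field: idempotent relations, Theorem B, characters -/

section Linear

variable (ℓ : ℕ) [Fact ℓ.Prime] {X : AbelianVariety K}

/-- **Dimensions of images from the `ℓ`-adic character**: if a quasi-idempotent `u` (`u ≫ u = a • u`) is an integral linear
combination `u = Σ_{i ∈ s} c_i w_i` of endomorphisms, then `a · 2 dim(Im u) = Σ_i c_i Tr(w_i | T_ℓ X)` (`ℓ` invertible in
`K`) — for `u = |G| e_W` built from group elements this is the character formula `dim A_W = ½ |G|⁻¹ Σ_g c_g Tr(ρ_ℓ(g))` of the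
group-algebra / isotypical components ("`dim B_i = ½ ⟨ρ_r, W_i⟩`", Lange–Rodríguez Prop. 2.9.3, `ℓ`-adically).
[cite: LangeRodriguez2022, §2.9.1 Prop. 2.9.3 and proof (PDF p. 46)] [cite: Milne1986AbelianVarieties, §12 Prop. 12.9 (PDF p. 192)]
[cite: DokchitserEtAl2022, §3 (additive functor lemma, `F = V_ℓ`)] -/
theorem mul_two_mul_dim_image_eq_sum_mul_trace_tateModuleMap {I : Type*} (s : Finset I) (c : I → ℤ) (w : I → (X ⟶ X))
    {u : X ⟶ X} {a : ℕ} (hu : u ≫ u = a • u) (hc : u = ∑ i ∈ s, c i • w i) (hℓ : (ℓ : K) ≠ 0) :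
    ((a * (2 * (image u).dim) : ℕ) : ℤ_[ℓ]) =
      ∑ i ∈ s, (c i : ℤ_[ℓ]) * LinearMap.trace ℤ_[ℓ] (X.tateModule ℓ) (tateModuleMap ℓ (w i)) := by
  rw [← trace_tateModuleMap_eq_mul_two_mul_dim ℓ hu hℓ, ← trace_tateModuleMap_sum_zsmul ℓ s c w, ← hc]

/-- **The dimension character of a literal idempotent relation, over ANY field**: if quasi-idempotents `u_i² = a_i u_i`,
`v_j² = b_j v_j` of `End X` satisfy `Σ_i c_i u_i = Σ_j d_j v_j` with `c_i, d_j ∈ ℤ` (i.e. `Σ_i c_i a_i ε_i = Σ_j d_j b_j ε'_j`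
for the idempotents), then **`Σ_i c_i a_i dim(Im u_i) = Σ_j d_j b_j dim(Im v_j)`** — the tree's perfect-field
`sum_mul_dim_image_eq_of_sum_nsmul_eq` (via the isogeny of Theorem A) freed of the perfectness hypothesis and of the sign
restriction, by evaluating the `ℓ`-adic character `Tr ∘ T_ℓ` (`ℓ ∈ {2, 3}` invertible in `K` chosen inside the proof).
[cite: KaniRosen1989, Thm. A] [cite: Paulhus2008, §2 Thm. 1 (p. 232)] [cite: Milne1986AbelianVarieties, §12 Prop. 12.9 (PDF p. 192)] -/
theorem sum_mul_dim_image_eq_of_sum_zsmul_eq {I J : Type} [Fintype I] [Fintype J] {u : I → (X ⟶ X)} {a : I → ℕ}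
    (hu : ∀ i, u i ≫ u i = a i • u i) {v : J → (X ⟶ X)} {b : J → ℕ} (hv : ∀ j, v j ≫ v j = b j • v j)
    {c : I → ℤ} {d : J → ℤ} (h : ∑ i, c i • u i = ∑ j, d j • v j) :
    ∑ i, c i * a i * ((image (u i)).dim : ℤ) = ∑ j, d j * b j * ((image (v j)).dim : ℤ) := by
  obtain ⟨ℓ, hℓp, hℓ⟩ := AbelianVariety.exists_prime_natCast_ne_zero K
  haveI : Fact ℓ.Prime := ⟨hℓp⟩
  have key := congrArg (fun w : X ⟶ X ↦ LinearMap.trace ℤ_[ℓ] (X.tateModule ℓ) (tateModuleMap ℓ w)) h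
  simp only [trace_tateModuleMap_sum_zsmul ℓ Finset.univ, trace_tateModuleMap_eq_mul_two_mul_dim ℓ (hu _) hℓ,
    trace_tateModuleMap_eq_mul_two_mul_dim ℓ (hv _) hℓ] at key
  have e : ∀ (z : ℤ) (n m : ℕ), (z : ℤ_[ℓ]) * ((n * (2 * m) : ℕ) : ℤ_[ℓ]) = ((z * n * m : ℤ) : ℤ_[ℓ]) * 2 := by
    intro z n m; push_cast; ring
  simp only [e, ← Finset.sum_mul, ← Int.cast_sum] at key
  exact Int.cast_injective (mul_left_injective₀ (two_ne_zero : (2 : ℤ_[ℓ]) ≠ 0) key)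

/-- The one-sided form: `u = Σ_j d_j v_j` for quasi-idempotents gives `a dim(Im u) = Σ_j d_j b_j dim(Im v_j)`; e.g. for the
isotypical decomposition `|G| · 1 = Σ_W |G| e_W`. [cite: KaniRosen1989, Thm. A] [cite: LangeRodriguez2022, §2.9.1 Prop. 2.9.3 (PDF p. 46)] -/
theorem mul_dim_image_eq_sum_of_eq_sum_zsmul {J : Type} [Fintype J] {u : X ⟶ X} {a : ℕ} (hu : u ≫ u = a • u)
    {v : J → (X ⟶ X)} {b : J → ℕ} (hv : ∀ j, v j ≫ v j = b j • v j) {d : J → ℤ} (h : u = ∑ j, d j • v j) :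
    (a * (image u).dim : ℤ) = ∑ j, d j * b j * ((image (v j)).dim : ℤ) := by
  have h' : ∑ _i : Unit, (1 : ℤ) • u = ∑ j, d j • v j := by rw [Fintype.sum_unique, one_smul, h]
  have := sum_mul_dim_image_eq_of_sum_zsmul_eq (u := fun _ : Unit ↦ u) (a := fun _ ↦ a) (fun _ ↦ hu) hv h'
  simpa only [Fintype.sum_unique, one_mul] using this

/-- **The dimension of `X` is the dimension character of `1`**: `a dim X = Σ_j d_j b_j dim(Im v_j)` whenever
`a • 1_X = Σ_j d_j v_j` for quasi-idempotents `v_j` (e.g. `X ∼ ∏_W A_W`, `dim X = Σ_W dim A_W`, over any field for the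
dimensions). [cite: KaniRosen1989, Thm. A] [cite: LangeRodriguez2022, §2.9.1 Thm. 2.9.1 and Prop. 2.9.3 (PDF pp. 43, 46)] -/
theorem mul_dim_eq_sum_of_nsmul_id_eq_sum_zsmul {J : Type} [Fintype J] {a : ℕ} {v : J → (X ⟶ X)} {b : J → ℕ}
    (hv : ∀ j, v j ≫ v j = b j • v j) {d : J → ℤ} (h : a • 𝟙 X = ∑ j, d j • v j) :
    (a * X.dim : ℤ) = ∑ j, d j * b j * ((image (v j)).dim : ℤ) := by
  obtain ⟨ℓ, hℓp, hℓ⟩ := AbelianVariety.exists_prime_natCast_ne_zero K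
  haveI : Fact ℓ.Prime := ⟨hℓp⟩
  have h' : ((a : ℕ) : ℤ) • 𝟙 X = ∑ j, d j • v j := by rw [natCast_zsmul, h]
  have key := congrArg (fun w : X ⟶ X ↦ LinearMap.trace ℤ_[ℓ] (X.tateModule ℓ) (tateModuleMap ℓ w)) h'
  rw [tateModuleMap_zsmul, map_zsmul, trace_tateModuleMap_id_eq_two_mul_dim ℓ X hℓ, zsmul_eq_mul] at key
  simp only [trace_tateModuleMap_sum_zsmul ℓ Finset.univ, trace_tateModuleMap_eq_mul_two_mul_dim ℓ (hv _) hℓ] at key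
  have e : ∀ (z : ℤ) (n m : ℕ), (z : ℤ_[ℓ]) * ((n * (2 * m) : ℕ) : ℤ_[ℓ]) = ((z * n * m : ℤ) : ℤ_[ℓ]) * 2 := by
    intro z n m; push_cast; ring
  have e0 : ∀ n m : ℕ, ((n : ℤ) : ℤ_[ℓ]) * ((2 * m : ℕ) : ℤ_[ℓ]) = ((n * m : ℤ) : ℤ_[ℓ]) * 2 := by
    intro n m; push_cast; ring
  simp only [e, e0, ← Finset.sum_mul, ← Int.cast_sum] at key
  exact Int.cast_injective (mul_left_injective₀ (two_ne_zero : (2 : ℤ_[ℓ]) ≠ 0) key)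

end Linear

end AbelianVariety

end Literature.AlgebraicGeometry.Motives
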